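import Literature.NumberTheory.EllipticCurves.HeegnerPointsKolyvaginPrimaryClassesProofs
import Literature.NumberTheory.EllipticCurves.HeegnerPointsKolyvaginPrimaryEulerProofs
import HarnessLib

/-!
# Leaf (A) of Kolyvagin's descent modulo `p^M` from points: the classes `c_M(n)` of `P_n`

Sibling proof file for the named fact
`Literature.NumberTheory.EllipticCurves.Kolyvagin1990_sha_primary_finite N W K` (Gross 1991,
Thm. 1.3 (2), `p`-primary part; McCallum 1991, §1 Theorem). The tree derives that fact
(`KolyvaginDescent.Kolyvagin1990_sha_primary_finite_of_leavesM_of_thmA`,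
`HeegnerPointsKolyvaginPrimaryLeavesProofs`) from two mod-`p^M` Euler-system leaves, of which
leaf **(A)** asks for a family of *classes* `c_M(n) ∈ H¹(K, E[p^M])` with `c_M(1) = δ_M y_K`,
Gross's Prop. 5.4 (2) (the sign under complex conjugation) and local properties (McCallum's
Lemma 4.3, Prop. 4.4). With McCallum's cocycle (`kolyvaginClass`,
`HeegnerPointsKolyvaginPrimaryClassesProofs`: Gross §4 (4.6), McCallum Lemma 4.1) and the
group-ring algebra of Gross §3 / Prop. 5.4 (1) (`KolyvaginEuler`,
`HeegnerPointsKolyvaginPrimaryEulerProofs`) now in the tree, this file **replaces the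
class-level leaf (A) by a point-level one**: the classes are *defined* as the Kolyvagin classes
of points `P_n ∈ E(K_n) ⊆ E(K̄)` (McCallum (4): `[P_n] ∈ (E(K_n)/p^M)^{𝒢_n}`), and

* `c_M(1) = δ_M y_K` is McCallum's (6) at `n = 1` / Gross (4.4) with `P_1 = y_K`
  (`kolyvaginClass_toGeomPoints`),
* Prop. 5.4 (2), `c_* c_M(n) = ε_n c_M(n)`, follows from Prop. 5.4 (1), the point congruence
  `τ P_n ≡ ε_n P_n (mod p^M E(K_n))` (`conjAct_kolyvaginClass_eq_smul`),

so that what remains hypothetical of leaf (A) is: the points `P_n` with McCallum's (4) and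
Gross's Prop. 5.4 (1) — themselves reduced by `KolyvaginEuler.smul_kolyvaginPoint_sub_mem` /
`KolyvaginEuler.conj_kolyvaginPoint_sub_mem` to the Heegner points `y_n ∈ E(K_n)` with the
Euler-system relation of Prop. 3.7 (1) and Prop. 5.3 (CM theory on `X₀(N)`, Eichler–Shimura,
Atkin–Lehner: not in the tree), see `KolyvaginEuler.isAdmissible_range`,
`KolyvaginEuler.map_mem_invPoints_of_forall_smul_sub_mem` below — and the LOCAL statements about
the classes of the `P_n` (Gross Prop. 6.2 / McCallum Lemma 4.3 at `v ∤ n` off the split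
places, and McCallum's Prop. 4.4 at `λ ∣ n`: Néron models, reduction mod `λ`, formal groups),
kept as the hypotheses `hloc`, `h44`. Leaf (B) (McCallum Lemma 5.3 + Prop. 2.2, local Tate
duality) is untouched. No named fact is introduced.

## Main statements

* `KolyvaginEuler.isAdmissible_range`, `KolyvaginEuler.map_mem_invPoints_of_forall_smul_sub_mem`
  — from a `𝒢_n`-module `A = E(K_n)` mapped equivariantly and injectively into `E(K̄)` to the
  hypotheses of `kolyvaginClass` (with `KolyvaginEuler.exists_map_eq_smul_add_zsmul_of_equivariant`
  of `HeegnerPointsKolyvaginPrimaryEulerProofs` for the congruence of Prop. 5.4 (1)).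
* `KolyvaginDescent.exists_leafA_of_points` — leaf (A) of `exists_hypothesesM_of_leavesM` from
  points.
* `KolyvaginDescent.Kolyvagin1990_sha_primary_finite_of_pointsM_of_thmA` — the named fact from:
  Čebotarev, the Weil pairing, `Kolyvagin1990_thmA_of_hasCM_or_discr` (named facts / leaf of the
  tree), the point-level leaf (A'), leaf (B), and [K1] for `p = 2` or `ρ̄_{E,p}` not onto.

## References

* B. H. Gross, *Kolyvagin's work on modular elliptic curves*, in *`L`-functions and arithmetic
  (Durham, 1989)*, LMS Lecture Note Ser. 153, CUP (1991), 235–256: §3 Props. 3.6, 3.7, §4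
  (4.1)–(4.6), Lemma 4.3, §5 Props. 5.3, 5.4, §6 Prop. 6.2 (held
  `book:editornd-l-functions-arithmetic`, PDF pp. 217–222). [GrossLMS1991]
* W. G. McCallum, *Kolyvagin's work on Shafarevich–Tate groups*, same volume, 295–316: §4
  ((4)–(6), Lemma 4.1, Lemma 4.3, Prop. 4.4), §5 (PDF pp. 281–286). [McCallumLMS1991]
* V. A. Kolyvagin, *Euler systems*, in *The Grothendieck Festschrift II*, Progr. Math. 87 (1990),
  435–483, Thm. A. [Kolyvagin1990] (cite only; not held.)
-/

noncomputable section

open scoped Classical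
open WeierstrassCurve NumberField IsDedekindDomain
open Literature.NumberTheory.GaloisRepresentations

universe u v

namespace Literature.NumberTheory.EllipticCurves

/-! ## From `E(K_n)` as a `𝒢_n`-module to the hypotheses of McCallum's cocycle -/

namespace KolyvaginEuler

section Transport

variable {𝒢 : Type*} [CommGroup 𝒢] {A : Type*} [AddCommGroup A] [DistribMulAction 𝒢 A]
variable {Γ : Type*} [Group Γ] {X : Type*} [AddCommGroup X] [DistribMulAction Γ X]

/-- **`E(K_n) ⊆ E(K̄)` is admissible**: the image of a `𝒢`-module `A` without `n`-torsion
(Gross 1991, Lemma 4.3: `E(K_n)[p] = 0`; tree: `torsionBy_pow_eq_bot`) under an injective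
additive map `j`, equivariant along `π : Γ → 𝒢`, is `Γ`-stable and `n`-torsion-free
(`KolyvaginCocycle.IsAdmissible`). [cite: GrossLMS1991, Lemma 4.3]
[cite: McCallumLMS1991, §4 (5)] -/
theorem isAdmissible_range (π : Γ →* 𝒢) (j : A →+ X)
    (hj : ∀ (g : Γ) (a : A), j (π g • a) = g • j a) (hinj : Function.Injective j) {n : ℤ}
    (hAn : ∀ a : A, n • a = 0 → a = 0) :
    KolyvaginCocycle.IsAdmissible Γ j.range n where
  smul_mem g := by
    rintro _ ⟨a, rfl⟩
    exact ⟨π g • a, hj g a⟩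
  eq_zero_of_zsmul := by
    rintro _ ⟨a, rfl⟩ ha
    rw [← map_zsmul] at ha
    rw [hAn a (hinj (by rw [ha, map_zero])), map_zero]

/-- **McCallum's (4) in `E(K̄)`**: if `γ P - P ∈ nA` for all `γ ∈ 𝒢` (conclusion of
`smul_kolyvaginPoint_sub_mem`), then `j P ∈ KolyvaginCocycle.invPoints Γ j(A) n`, the hypothesis
of `kolyvaginClass`. [cite: McCallumLMS1991, §4 (4)] -/
theorem map_mem_invPoints_of_forall_smul_sub_mem (π : Γ →* 𝒢) (j : A →+ X)
    (hj : ∀ (g : Γ) (a : A), j (π g • a) = g • j a) {n : ℤ} {P : A}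
    (hP : ∀ γ : 𝒢, γ • P - P ∈ zsmulRange A n) :
    j P ∈ KolyvaginCocycle.invPoints Γ j.range n :=
  ⟨⟨P, rfl⟩, exists_zsmul_eq_smul_sub_of_equivariant π j hj hP⟩

end Transport

end KolyvaginEuler

/-! ## Leaf (A) from points -/

namespace KolyvaginDescent

section Points

variable {N : ℕ} [NeZero N] {W : WeierstrassCurve ℚ} {K : Type u} [Field K] [NumberField K]

/-- Kolyvagin classes of equal points are equal (proof-irrelevance helper). [folklore] -/
theorem kolyvaginClass_congr_point {n : ℤ}
    {hdiv : ∀ Q : geomPoints (W.baseChange K), ∃ R : geomPoints (W.baseChange K), n • R = Q}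
    {A : AddSubgroup (geomPoints (W.baseChange K))}
    (hA : KolyvaginCocycle.IsAdmissible (Field.absoluteGaloisGroup K) A n)
    {P P' : geomPoints (W.baseChange K)}
    {hP : P ∈ KolyvaginCocycle.invPoints (Field.absoluteGaloisGroup K) A n}
    {hP' : P' ∈ KolyvaginCocycle.invPoints (Field.absoluteGaloisGroup K) A n} (h : P = P') :
    kolyvaginClass (W.baseChange K) n hdiv hA P hP = kolyvaginClass (W.baseChange K) n hdiv hA P' hP' := by
  subst h
  rfl

omit [NeZero N] in
/-- **Leaf (A) of `exists_hypothesesM_of_leavesM` from points.** Fix `p`, `M`, the complex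
conjugation `c` of `K` with a lift `τ` to `K̄`, a sign `ε`, and for every `m` a `Γ_K`-stable,
`p^M`-torsion-free subgroup `A_m ⊆ E(K̄)` stable under `τ` (printed: `A_m = E(K_m)`, Gross
Lemma 4.3) and a point `P_m ∈ A_m` with `(g-1)P_m ∈ p^M A_m` for all `g ∈ Γ_K` (McCallum (4)),
`P_1 = y_K` (Gross (4.1): `P_1 = Tr_{K_1/K} y_1 = y_K`) and, for the square-free products `m` of
Kolyvagin primes of level `M`, the congruence `τ P_m ≡ ε (-1)^{f_m} P_m (mod p^M A_m)` (Gross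
Prop. 5.4 (1)). **Define** `c_M(m)` as the Kolyvagin class of `P_m` (McCallum's cocycle,
Lemma 4.1). Then `c_M(1) = δ_M y_K` (McCallum (6)) and `c_* c_M(m) = ε (-1)^{f_m} c_M(m)` (Gross
Prop. 5.4 (2)) are theorems, and together with the local hypotheses `hloc` (McCallum Lemma 4.3 /
Gross Prop. 6.2 (1): the Selmer condition at `v ∤ m`) and `h44` (McCallum Prop. 4.4 in the form
the descent consumes) about these classes they make up leaf (A) verbatim.
[cite: McCallumLMS1991, §4 (4)–(6), Lemma 4.1, Lemma 4.3, Prop. 4.4]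
[cite: GrossLMS1991, §4 (4.1), (4.4), Prop. 5.4] -/
theorem exists_leafA_of_points {P : (W.baseChange K).toAffine.Point} {p M : ℕ}
    (hdiv : ∀ Q : geomPoints (W.baseChange K), ∃ R, ((p ^ M : ℕ) : ℤ) • R = Q)
    (c : K ≃ₐ[ℚ] K) {τ : AlgebraicClosure K ≃+* AlgebraicClosure K} (hτ : IsLiftOfAut c τ)
    (ε : ℤ) (A : ℕ → AddSubgroup (geomPoints (W.baseChange K)))
    (hA : ∀ m, KolyvaginCocycle.IsAdmissible (Field.absoluteGaloisGroup K) (A m) ((p ^ M : ℕ) : ℤ))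
    (hAτ : ∀ m, ∀ a ∈ A m, hτ.pointsMap W a ∈ A m)
    (Pt : ℕ → geomPoints (W.baseChange K))
    (hPt : ∀ m, Pt m ∈
      KolyvaginCocycle.invPoints (Field.absoluteGaloisGroup K) (A m) ((p ^ M : ℕ) : ℤ))
    (hPt1 : Pt 1 = toGeomPoints (W.baseChange K) P)
    (h541 : ∀ m : ℕ, Squarefree m →
      (∀ q ∈ m.primeFactors, IsKolyvaginPrime N W K p q ∧ FrobEqFrobInfty W K (p ^ M) q) →
      ∃ B ∈ A m, hτ.pointsMap W (Pt m) =
        (ε * (-1) ^ m.primeFactors.card) • Pt m + ((p ^ M : ℕ) : ℤ) • B)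
    (hloc : ∀ m : ℕ, Squarefree m →
      (∀ q ∈ m.primeFactors, IsKolyvaginPrime N W K p q ∧ FrobEqFrobInfty W K (p ^ M) q) →
      ∀ v : HeightOneSpectrum (𝓞 K), (m : 𝓞 K) ∉ v.asIdeal →
        kolyvaginClass (W.baseChange K) _ hdiv (hA m) (Pt m) (hPt m) ∈
          selmerLocalKer (W.baseChange K) (v.adicCompletion K) ((p ^ M : ℕ) : ℤ))
    (h44 : ∀ m : ℕ, Squarefree m →
      (∀ q ∈ m.primeFactors, IsKolyvaginPrime N W K p q ∧ FrobEqFrobInfty W K (p ^ M) q) →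
      ∀ ℓ : ℕ, ℓ.Prime → ℓ ∣ m → ∀ v : HeightOneSpectrum (𝓞 K), (ℓ : 𝓞 K) ∈ v.asIdeal →
        ∀ a : ℕ, (((p : ℤ) ^ a) • kolyvaginClass (W.baseChange K) _ hdiv (hA m) (Pt m) (hPt m) ∈
            selmerLocalKer (W.baseChange K) (v.adicCompletion K) ((p ^ M : ℕ) : ℤ) ↔
          ((p : ℤ) ^ a) • kolyvaginClass (W.baseChange K) _ hdiv (hA (m / ℓ)) (Pt (m / ℓ))
              (hPt (m / ℓ)) ∈
            (W.baseChange K).torsionLocalKer (v.adicCompletion K) ((p ^ M : ℕ) : ℤ))) :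
    ∃ cl : ℕ → galH1Torsion (W.baseChange K) ((p ^ M : ℕ) : ℤ),
      cl 1 = kummerMapTorsion (W.baseChange K) _ hdiv P ∧
      (∀ m : ℕ, Squarefree m →
        (∀ q ∈ m.primeFactors, IsKolyvaginPrime N W K p q ∧ FrobEqFrobInfty W K (p ^ M) q) →
        conjAct W c _ (cl m) = (ε * (-1) ^ m.primeFactors.card) • cl m ∧
        (∀ v : HeightOneSpectrum (𝓞 K), (m : 𝓞 K) ∉ v.asIdeal →
          cl m ∈ selmerLocalKer (W.baseChange K) (v.adicCompletion K) ((p ^ M : ℕ) : ℤ)) ∧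
        (∀ ℓ : ℕ, ℓ.Prime → ℓ ∣ m → ∀ v : HeightOneSpectrum (𝓞 K), (ℓ : 𝓞 K) ∈ v.asIdeal →
          ∀ a : ℕ, (((p : ℤ) ^ a) • cl m ∈
              selmerLocalKer (W.baseChange K) (v.adicCompletion K) ((p ^ M : ℕ) : ℤ) ↔
            ((p : ℤ) ^ a) • cl (m / ℓ) ∈
              (W.baseChange K).torsionLocalKer (v.adicCompletion K) ((p ^ M : ℕ) : ℤ)))) := by
  refine ⟨fun m ↦ kolyvaginClass (W.baseChange K) _ hdiv (hA m) (Pt m) (hPt m), ?_, ?_⟩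
  · -- `c_M(1) = δ_M y_K`
    have h1 : toGeomPoints (W.baseChange K) P ∈
        KolyvaginCocycle.invPoints (Field.absoluteGaloisGroup K) (A 1) ((p ^ M : ℕ) : ℤ) := by
      rw [← hPt1]; exact hPt 1
    change kolyvaginClass (W.baseChange K) _ hdiv (hA 1) (Pt 1) (hPt 1) = _
    rw [kolyvaginClass_congr_point (hA 1) (hP' := h1) hPt1]
    exact kolyvaginClass_toGeomPoints (hA 1) P h1
  · intro m hm hkol
    refine ⟨?_, hloc m hm hkol, h44 m hm hkol⟩
    -- Prop. 5.4 (2) from (1)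
    exact conjAct_kolyvaginClass_eq_smul W hτ (hA m) (hAτ m) (hPt m) _ (h541 m hm hkol)

end Points

/-! ## The named fact from the point-level leaf (A') -/

variable (N : ℕ) [NeZero N] (W : WeierstrassCurve ℚ) (K : Type u) [Field K] [NumberField K]

/-- **`Kolyvagin1990_sha_primary_finite` from Heegner-type points.** The named fact (Gross 1991,
Thm. 1.3 (2), `p`-primary part) follows from: the Čebotarev density theorem
(`Automorphic.chebotarev_artinRep`) and the Weil pairing (`exists_weilPairing`) — named facts of
the tree; the tree's leaf `Kolyvagin1990_thmA_of_hasCM_or_discr` (CM / `d_K ∈ {-3, -4}`); and,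
for `E` without CM, `d_K ∉ {-3, -4}`, every odd `p` with `ρ̄_{E,p}` onto, every `M ≥ 1` and the
complex conjugation `c ≠ 1` of `K`, the hypothesis `hpoints` = **leaf (A')**: a sign `ε = ±1`
with Gross's Prop. 5.3 for `y_K` (`c y_K - ε y_K` torsion), a lift `τ` of `c` to `K̄`, and for
every `m` a `Γ_K`- and `τ`-stable, `p^M`-torsion-free subgroup `A_m ⊆ E(K̄)` (printed `E(K_m)`,
Gross Lemma 4.3 — tree: `torsionBy_pow_eq_bot_of_normal_of_hasSurjectiveModNGaloisRep`) with a
point `P_m ∈ A_m`, `[P_m] ∈ (A_m/p^M)^{Γ_K}` (McCallum (4) — tree: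
`KolyvaginEuler.smul_kolyvaginPoint_sub_mem`), `P_1 = y_K`, `τ P_m ≡ ε(-1)^{f_m} P_m` for the
Kolyvagin levels (Prop. 5.4 (1) — tree: `KolyvaginEuler.conj_kolyvaginPoint_sub_mem`), and the
local behaviour of the Kolyvagin classes of the `P_m` (McCallum Lemma 4.3, Prop. 4.4 — Néron
models and reduction, hypotheses); together with **leaf (B)** (`hdual`: McCallum Lemma 5.3 with
Prop. 2.2, local Tate duality) and `hK1` ([K1], Thm. A, for `p = 2` or `ρ̄_{E,p}` not onto). The
classes `c_M(m)`, their value at `m = 1` and their signs are now theorems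
(`exists_leafA_of_points`). [cite: GrossLMS1991, §1 Thm. 1.3 (2), §§3–5]
[cite: McCallumLMS1991, §1 Theorem (Kolyvagin), §§4–5] -/
theorem Kolyvagin1990_sha_primary_finite_of_pointsM_of_thmA (hC : Automorphic.chebotarev_artinRep)
    (hW : ∀ p : ℕ, p.Prime → W.exists_weilPairing p)
    (hexc : Kolyvagin1990_thmA_of_hasCM_or_discr N W K)
    (hpoints : ∀ [W.IsElliptic] (_hE : ¬ W.HasCM) (_hK : IsImaginaryQuadratic K)
      (_hD : NumberField.discr K ≠ -3 ∧ NumberField.discr K ≠ -4)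
      (_hH : SatisfiesHeegnerHypothesis N K)
      {P : (W.baseChange K).toAffine.Point} (_hP : IsHeegnerPoint N W K P)
      (_hnt : ¬ IsOfFinAddOrder P) {p : ℕ} (_hp : p.Prime) (_hp2 : p ≠ 2)
      (_hρ : W.HasSurjectiveModNGaloisRep p) {M : ℕ} (_hM : 1 ≤ M)
      (hdiv : ∀ Q : geomPoints (W.baseChange K), ∃ R, ((p ^ M : ℕ) : ℤ) • R = Q)
      (c : K ≃ₐ[ℚ] K) (_hc : c ≠ 1),
      ∃ (ε : ℤ) (τ : AlgebraicClosure K ≃+* AlgebraicClosure K) (hτ : IsLiftOfAut c τ)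
        (A : ℕ → AddSubgroup (geomPoints (W.baseChange K)))
        (hA : ∀ m, KolyvaginCocycle.IsAdmissible (Field.absoluteGaloisGroup K) (A m)
          ((p ^ M : ℕ) : ℤ))
        (Pt : ℕ → geomPoints (W.baseChange K))
        (hPt : ∀ m, Pt m ∈
          KolyvaginCocycle.invPoints (Field.absoluteGaloisGroup K) (A m) ((p ^ M : ℕ) : ℤ)),
        (ε = 1 ∨ ε = -1) ∧
        IsOfFinAddOrder (Affine.Point.map (W' := W) (c : K →ₐ[ℚ] K) P - ε • P) ∧
        (∀ m, ∀ a ∈ A m, hτ.pointsMap W a ∈ A m) ∧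
        Pt 1 = toGeomPoints (W.baseChange K) P ∧
        (∀ m : ℕ, Squarefree m →
          (∀ q ∈ m.primeFactors, IsKolyvaginPrime N W K p q ∧ FrobEqFrobInfty W K (p ^ M) q) →
          (∃ B ∈ A m, hτ.pointsMap W (Pt m) =
            (ε * (-1) ^ m.primeFactors.card) • Pt m + ((p ^ M : ℕ) : ℤ) • B) ∧
          (∀ v : HeightOneSpectrum (𝓞 K), (m : 𝓞 K) ∉ v.asIdeal →
            kolyvaginClass (W.baseChange K) _ hdiv (hA m) (Pt m) (hPt m) ∈
              selmerLocalKer (W.baseChange K) (v.adicCompletion K) ((p ^ M : ℕ) : ℤ)) ∧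
          (∀ ℓ : ℕ, ℓ.Prime → ℓ ∣ m → ∀ v : HeightOneSpectrum (𝓞 K), (ℓ : 𝓞 K) ∈ v.asIdeal →
            ∀ a : ℕ, (((p : ℤ) ^ a) •
                kolyvaginClass (W.baseChange K) _ hdiv (hA m) (Pt m) (hPt m) ∈
                selmerLocalKer (W.baseChange K) (v.adicCompletion K) ((p ^ M : ℕ) : ℤ) ↔
              ((p : ℤ) ^ a) • kolyvaginClass (W.baseChange K) _ hdiv (hA (m / ℓ)) (Pt (m / ℓ))
                  (hPt (m / ℓ)) ∈
                (W.baseChange K).torsionLocalKer (v.adicCompletion K) ((p ^ M : ℕ) : ℤ)))) ∧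
        (∀ ℓ : ℕ, IsKolyvaginPrime N W K p ℓ ∧ FrobEqFrobInfty W K (p ^ M) ℓ →
          ∀ ν : ℤ, (ν = 1 ∨ ν = -1) → ∀ d : galH1Torsion (W.baseChange K) ((p ^ M : ℕ) : ℤ),
          conjAct W c _ d = ν • d →
          (∀ v : HeightOneSpectrum (𝓞 K), (ℓ : 𝓞 K) ∉ v.asIdeal →
            d ∈ selmerLocalKer (W.baseChange K) (v.adicCompletion K) ((p ^ M : ℕ) : ℤ)) →
          (∀ w : InfinitePlace K,
            d ∈ selmerLocalKer (W.baseChange K) w.Completion ((p ^ M : ℕ) : ℤ)) →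
          ∀ s ∈ selmerGroup (W.baseChange K) ((p ^ M : ℕ) : ℤ), conjAct W c _ s = ν • s →
          ∀ a : ℕ, a < M → ∀ v : HeightOneSpectrum (𝓞 K), (ℓ : 𝓞 K) ∈ v.asIdeal →
            ((p : ℤ) ^ a) • d ∉
              selmerLocalKer (W.baseChange K) (v.adicCompletion K) ((p ^ M : ℕ) : ℤ) →
            ((p : ℤ) ^ (M - 1 - a)) • s ∈
              (W.baseChange K).torsionLocalKer (v.adicCompletion K) ((p ^ M : ℕ) : ℤ)))
    (hK1 : ∀ [W.IsElliptic] (_hE : ¬ W.HasCM)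
      (_hD : NumberField.discr K ≠ -3 ∧ NumberField.discr K ≠ -4) (_hK : IsImaginaryQuadratic K)
      (_hH : SatisfiesHeegnerHypothesis N K) {P : (W.baseChange K).toAffine.Point}
      (_hP : IsHeegnerPoint N W K P) (_hnt : ¬ IsOfFinAddOrder P) (p : ℕ) (_hp : p.Prime),
      (p = 2 ∨ ¬ W.HasSurjectiveModNGaloisRep p) →
      Set.Finite {c : (W.baseChange K).sha | ∃ j : ℕ, p ^ j • c = 0}) :
    Kolyvagin1990_sha_primary_finite N W K := by
  refine Kolyvagin1990_sha_primary_finite_of_leavesM_of_thmA N W K hC hW hexc ?_ hK1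
  intro _ hE hK hD hH P hP hnt p hp hp2 hρ M hM hdiv c hc
  obtain ⟨ε, τ, hτ, A, hA, Pt, hPt, hε, h53, hAτ, hPt1, hm, hdual⟩ :=
    hpoints hE hK hD hH hP hnt hp hp2 hρ hM hdiv c hc
  obtain ⟨cl, hc1, hcl⟩ := exists_leafA_of_points (N := N) hdiv c hτ ε A hA hAτ Pt hPt hPt1
    (fun m hm' hk ↦ (hm m hm' hk).1) (fun m hm' hk ↦ (hm m hm' hk).2.1)
    (fun m hm' hk ↦ (hm m hm' hk).2.2)
  exact ⟨ε, cl, hε, h53, hc1, hcl, hdual⟩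

end KolyvaginDescent

end Literature.NumberTheory.EllipticCurves
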